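import Literature.AnabelianGeometry.SemiGraphs.ProSigmaClosedSurfaceSlim
import Literature.AnabelianGeometry.SemiGraphs.ProSigmaCompletionModels
import Literature.GroupTheory.CombinatorialGroupTheory.SurfaceGroupFiniteIndexSubgroupHolds
import Literature.GroupTheory.CombinatorialGroupTheory.PuncturedSurfaceGroupFree
import Literature.GroupTheory.FreeGroupProfiniteCompletionSlim
import HarnessLib

/-!
# The profinite completion of a closed surface group of genus `≥ 2` is slim

Topic `Literature/GroupTheory` — companion of `FreeGroupProfiniteCompletionSlim.lean` (the punctured
case; abc-iut cell campaign-L R1, GAP row G-L4t14-R1): for a group `G` isomorphic to the closed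
orientable surface group `S_g = ⟨a₁, b₁, …, a_g, b_g ∣ ∏ [aᵢ, bᵢ]⟩` of genus `g ≥ 2` (the tree's
`Literature.Topology.FourManifolds.SurfaceGroup g`), the profinite completion `Ĝ` (the tree's
`Literature.IUT.HodgeTheaters.profiniteCompletion G` = Mathlib's `ProfiniteGrp.ProfiniteCompletion`)
is SLIM: every open subgroup has trivial centraliser.  UNCONDITIONAL junction of three theorems of
the tree:

* `SemiGraphOfAnabelioids.IsProSigmaCompletion.isSlimGroup_of_surfaceGroup`
  (`ProSigmaClosedSurfaceSlim.lean`; [AbsAnab] Lemma 1.3.1, proper case, modulo F_cov),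
* `surfaceGroupFiniteIndexSubgroup_holds` (`SurfaceGroupFiniteIndexSubgroupHolds.lean`: F_cov — a
  finite-index subgroup of `S_g` is an `S_h` — PROVED), and
* `SemiGraphOfAnabelioids.IsProSigmaCompletion.isProSigmaCompletion_toCompletion`
  (`ProSigmaCompletionModels.lean`: `η : G → Ĝ` is a pro-`{all primes}` completion).

Main statements: `isSlimGroup_profiniteCompletion_of_mulEquiv_surfaceGroup`,
`isSlimGroup_profiniteCompletion_surfaceGroup` — the group-theoretic input for «`Cov^fin` of a
compact hyperbolic Riemann surface of genus `g ≥ 2` is id-rigid» (the topological input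
`π₁(Σ_g) ≅ S_g` is not in the tree yet) — and the UNIFIED form for every hyperbolic type `(g, r)`,
`isSlimGroup_profiniteCompletion_of_mulEquiv_puncturedSurfaceGroup` (closed case here, punctured case
`r ≥ 1` by `FreeGroupProfiniteCompletionSlim.lean`, `Γ_{g,r}` being free of rank `2g + r - 1 ≥ 2`).
The literal instance `IsSlimGroup (profiniteCompletion (PuncturedSurfaceGroup g r))` is already the
tree's `Literature.AnabelianGeometry.AbsoluteAnabelian.isSlimGroup_profiniteCompletion_puncturedSurfaceGroup`
(`FiniteGSetsIdRigid.lean`, via F-0037 `proSigmaSurfaceGroupSlim_holds`); this file supplies the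
transported forms along an abstract group isomorphism.  Proof-only: no definitions, no named facts.

## References
* S. Mochizuki, *The absolute anabelian geometry of hyperbolic curves* (2004), Lemma 1.3.1.
  [MochizukiAbsAnab2004]
-/

noncomputable section

namespace Literature.GroupTheory

open Literature.AlgebraicGeometry.Frobenioids (IsSlimGroup)
open Literature.IUT.HodgeTheaters (profiniteCompletion toCompletion)
open Literature.AnabelianGeometry.SemiGraphs
open Literature.GroupTheory.CombinatorialGroupTheory
open Literature.Topology.FourManifolds (SurfaceGroup)

universe u

/-- **The profinite completion of a group isomorphic to the closed surface group `S_g`, `g ≥ 2`, is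
slim** ([AbsAnab] Lemma 1.3.1, proper case, for `Σ = {all primes}`; F_cov supplied by the tree's theorem
`surfaceGroupFiniteIndexSubgroup_holds`). [cite: MochizukiAbsAnab2004, Lemma 1.3.1 p.15] -/
theorem isSlimGroup_profiniteCompletion_of_mulEquiv_surfaceGroup {G : Type u} [Group G] {g : ℕ}
    (e : G ≃* SurfaceGroup g) (hg : 2 ≤ g) : IsSlimGroup (profiniteCompletion G) :=
  SemiGraphOfAnabelioids.IsProSigmaCompletion.isSlimGroup_of_surfaceGroup
    surfaceGroupFiniteIndexSubgroup_holds hg e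
    (SemiGraphOfAnabelioids.IsProSigmaCompletion.isProSigmaCompletion_toCompletion G)

/-- The profinite completion `Ŝ_g` of the closed surface group of genus `g ≥ 2` is slim.
[cite: MochizukiAbsAnab2004, Lemma 1.3.1 p.15] -/
theorem isSlimGroup_profiniteCompletion_surfaceGroup {g : ℕ} (hg : 2 ≤ g) :
    IsSlimGroup (profiniteCompletion (SurfaceGroup g)) :=
  isSlimGroup_profiniteCompletion_of_mulEquiv_surfaceGroup (MulEquiv.refl _) hg

/-- The same for the tree's one-relator presentation `Γ_{g,0} = PuncturedSurfaceGroup g 0` of the closed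
surface group (`IsProSigmaCompletion.nonempty_mulEquiv_puncturedSurfaceGroup_zero`, `ProSigmaSurfaceCharacters.lean`).
[cite: MochizukiAbsAnab2004, Lemma 1.3.1 p.15] -/
theorem isSlimGroup_profiniteCompletion_puncturedSurfaceGroup_zero {g : ℕ} (hg : 2 ≤ g) :
    IsSlimGroup (profiniteCompletion (PuncturedSurfaceGroup g 0)) := by
  obtain ⟨e⟩ := SemiGraphOfAnabelioids.IsProSigmaCompletion.nonempty_mulEquiv_puncturedSurfaceGroup_zero g
  exact isSlimGroup_profiniteCompletion_of_mulEquiv_surfaceGroup e hg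

/-- **Unified form, all hyperbolic types**: for `G ≃* Γ_{g,r}` (`PuncturedSurfaceGroup g r`) with
`2g - 2 + r > 0`, the profinite completion `Ĝ` is slim — closed case (`r = 0`, `g ≥ 2`) by the surface
group, punctured case (`r ≥ 1`) because `Γ_{g,r}` is free of rank `2g + r - 1 ≥ 2`
(`PuncturedSurfaceGroup.nonempty_mulEquiv_freeGroup`, `isSlimGroup_profiniteCompletion_of_isFreeGroup`).
[cite: MochizukiAbsAnab2004, Lemma 1.3.1 p.15] -/
theorem isSlimGroup_profiniteCompletion_of_mulEquiv_puncturedSurfaceGroup {G : Type u} [Group G]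
    {g r : ℕ} (e : G ≃* PuncturedSurfaceGroup g r) (h : PuncturedSurfaceGroup.IsHyperbolicType g r) :
    IsSlimGroup (profiniteCompletion G) := by
  cases r with
  | zero =>
    have hg : 2 ≤ g := by unfold PuncturedSurfaceGroup.IsHyperbolicType at h; omega
    obtain ⟨e₀⟩ := SemiGraphOfAnabelioids.IsProSigmaCompletion.nonempty_mulEquiv_puncturedSurfaceGroup_zero g
    exact isSlimGroup_profiniteCompletion_of_mulEquiv_surfaceGroup (e.trans e₀) hg
  | succ r' =>
    obtain ⟨f⟩ := PuncturedSurfaceGroup.nonempty_mulEquiv_freeGroup g r'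
    haveI : IsFreeGroup G := IsFreeGroup.ofMulEquiv (e.trans f).symm
    exact isSlimGroup_profiniteCompletion_of_isFreeGroup
      (exists_mul_ne_mul_of_mulEquiv e (PuncturedSurfaceGroup.exists_mul_ne_mul h))

end Literature.GroupTheory

end
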